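import Mathlib.Analysis.InnerProductSpace.Projection.FiniteDimensional
import Mathlib.LinearAlgebra.FiniteDimensional.Basic
import HarnessLib

/-!
# K0⁷ STUB 1 (`stub_prop8StepCoP13`), sub-target S4a «THE HEART, flat half»: **[15] (127) ⟹ (128) ⟹ (133)∕(143) ⟹ (158) COORDINATE-FREE** —
# the derivation of the critical-point equation `A₀ = −G̃((δ∕δA′)V)(A₀ + HB)` from criticality on the tangent space `{QδA′ = 0}` over an ARBITRARY
# finite-dimensional real inner-product space (the record's 𝔰𝔲(2)-valued bond fields with the trace pairing), with `G̃` = the solution operator of the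
# quadratic form `⟨·, Δ_a·⟩` RESTRICTED to the tangent space — so that the record's chain needs no coordinatisation of 𝔰𝔲(2)

Cell `pub-ymgap`, width seat `pub-ymgap-k0-s1-w1` g0 (plan g77 W-SEAT-START-LIST v3 §k0-s1, w1 ↦ S4a «transfer UST `FlatCriticalEquation143` ((127) ⟹ (133)∕(143)) +
`FlatSmallSolution158*` to the record's objects»).  `--kind proof --supports stmt-QuantumFields-20541 --as helper`; count-neutral.  Companion of this seat's
`BalabanUVNodesK0Stub1FlatSmallSolution158AtRecord` (Prop. 6 for (158) read at the record).  [15] = [Balaban1985Variational] = T. Bałaban, CMP **102** (1985) 277–309.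

WHY.  UST's `FlatCriticalEquation143` (cell ym3-torus, pillar F4 part 5) proves (127) ⟹ (143) as exact linear algebra over REAL MATRICES on finite index
types (`Δ_a : Matrix ι ι ℝ`, `Q : Matrix κ ι ℝ`, `G = Δ_a⁻¹`, `K = QGQᵀ`, `H₀ = GQᵀK⁻¹`, `G̃ = G − GQᵀK⁻¹QG`, vectors `ι → ℝ`, `dotProduct`).  NODE 00's objects are
not coordinate vectors: the tangent directions are `X : PBond (F.P K) 0 → lieSU (Fin 2)` (`Node00.CriticalOnFibreTangent.expChart`), the (27)∕(141) pairing is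
`Σ_b Re Tr(U_bX_bU_b⋆ · J(b))` (dag-n07-e 35f∕35g `…N07CritCurrentForm.sum_re_trace_covDivT_eq_zero_of_hasDerivAt_zero`), and S1 (dag-n07-w1) types `Δ(1)`,
`Q_k`, `R` as operators on such fields.  Using the matrix theorem there would need a basis of 𝔰𝔲(2) and a dictionary trace-pairing ↔ `dotProduct`.
THIS FILE restates the derivation ONCE over an arbitrary finite-dimensional real inner-product space `E` (fields) and real vector space `F` (constraint
values), with the tangent space an arbitrary submodule `T` (print: `{δA′ : QδA′ = 0, RD*δA′ = 0}` (83) ∕ `{QA′ = 0}` (131)) and `G̃` characterised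
INTRINSICALLY: `G̃w` = the unique `z ∈ T` with `⟨δ, Δ_a z⟩ = ⟨δ, w⟩` for all `δ ∈ T` (the solution operator of the form `½⟨A′, Δ_aA′⟩` restricted to `T`;
in coordinates `GP₀* = G − GQ*(QGQ*)⁻¹QG = G̃`, p. 300) — existence, uniqueness and LINEARITY of `G̃` from positivity of `Δ_a` on `T` alone
(finite dimension; no invertibility of `Δ_a` on all of `E` is needed, matching Sect. F where `Δ_a` is used on the cube with boundary conditions).

THE PRINT (pp. 297–298, 300, 302): *«⟨δA′, J⟩ + ⟨δA′, ΔA′₁⟩ + ⟨δA′, (δ∕δA′)V(A′₁)⟩ = 0 (127) for all δA′ satisfying QδA′ = 0. The configuration A′₁ satisfies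
RD*A′₁ = 0, hence the above equation can be written as ⟨δA′, J⟩ + ⟨δA′, Δ_aA′₁⟩ + ⟨δA′, (δ∕δA′)V(A′₁)⟩ = 0, (128) where Δ_a = Δ + DRD* + Q*aQ … We decompose
A′₁ = A₀ + H₀B … By the definition of H₀B and the condition QδA′ = 0 we have ⟨δA′, Δ_aH₀B⟩ = 0. … P₀A₀ = A₀ … A₀ = −GP₀*J … − GP₀*((δ∕δA′)V)(A₀ + H₀B) (133)»*;
*«GP₀* = G̃, hence … A₀ = −G̃J + … − G̃((δ∕δA′)V)(A₀ + H₀B). (143)»*; *«In the considered case it can be written as A₁ + G̃((δ∕δA′)V)(A₁ + HB) = 0. (158)»*.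

WHAT IS PROVED (sorry-free; no definition; axioms standard; [folklore] finite-dimensional linear algebra instantiating the printed steps).
* §1 `existsUnique_restricted_solution` — for `Δ : E →ₗ[ℝ] E` with `0 < ⟨z, Δz⟩` for `z ∈ T ∖ {0}`: every `w` has a UNIQUE `z ∈ T` with `⟨δ, Δz⟩ = ⟨δ, w⟩`
  for all `δ ∈ T`; `exists_restrictedSolutionOp` — the solution map is a LINEAR operator `G̃ : E →ₗ[ℝ] E` with values in `T` («GP₀* = G̃»), unique.
* §2 `critical128_of_critical127` — (127) ⟹ (128): adding `N` with `N A′ = 0` (print `N = DRD*`, `RD*A′₁ = 0`) and `P` with `⟨δ, PA′⟩ = 0` on `T` (print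
  `P = Q*aQ`, `QδA′ = 0`) does not change the pairing on `T`.
* §3 `restricted_of_critical128` — (128) ⟹ (132): for a right inverse `H` of `Q` whose range is `Δ_a`-orthogonal to `T = ker Q` (print's `H₀`, or Sect. F's
  `H`), `A₀ := A′ − H(QA′)` lies in `T` and `⟨δ, Δ_aA₀ + w⟩ = 0` on `T`; ★ `eq143_of_critical128` — hence `A₀ = −G̃w` ((133)∕(143) with `w = J + ((δ∕δA′)V)(A′)`);
  ★ `eq158_of_critical128` — at background `1` (`J = 0`, `w = W(A′)`, `B := QA′`, `𝔄 := HB`): `A₁ + G̃(W(A₁ + 𝔄)) = 0` with `A₁ := A′ − HB` — EXACTLY the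
  equation shape of [15] Prop. 6 ∕ UST `FlatSmallSolution158*.existsUnique_smallSolution158*` (`A₁ + G (W (A₁ + 𝔄)) = 0`), so the unique small solution
  there IS the tangent component of the critical configuration; `critical128_of_eq143` — the converse.
HONEST SCOPE.  (i) Which `E`, `⟨·,·⟩`, `Δ`, `Q`, `H`, `W` (at the record: 𝔰𝔲(2)-valued fine bond fields on the cube (144) with the trace form, S1's `Δ(1)` +
`DRD*` + `aQ*Q`, the linearised multi-level (0.4)-constraint of S2's chart, Sect. F's `H`, Prop. 4's `(δ∕δA′)V`) is the consumer's; (ii) the passage from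
curve-criticality on the fibre to (127) on the tangent space is dag-n07-e 35a∕35g + S2's chart (GAP-STATED(submersion) for the multi-scale fibre,
`LOCATED-MULTISCALE-FIBRE.md`); (iii) nothing of [15]'s analysis; `stub_prop8StepCoP13` ∕ K0⁷ NOT closed; N07 NOT discharged; counts unmoved (28∕28 · 5∕27);
one finite 𝕋⁴ programme at fixed ε — R4 closes the conditional finite-𝕋⁴ rung `BalabanLadder.UV` only, never the summit; the YM mass gap (Clay) is NOT
proved by any of this; nothing continuum ∕ ℝ⁴ ∕ OS.  No `sorry`, no `def`, no `instance`, no `notation`.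

References: [15] (127)–(133) pp.297–298, (141)–(143) pp.299–300, (158) p.302; UST `Summit.QuantumFields.YangMills.Theorems.FlatCriticalEquation143` (matrix form).
-/

set_option autoImplicit false

noncomputable section

namespace Summit.QuantumFields.YangMills.Theorems.K0Stub1CriticalEquation143CoordFree

open scoped RealInnerProductSpace

variable {E : Type*} [NormedAddCommGroup E] [InnerProductSpace ℝ E] [FiniteDimensional ℝ E]
variable {F : Type*} [AddCommGroup F] [Module ℝ F]

/-! ## §1  The solution operator `G̃` of the form `⟨·, Δ_a ·⟩` restricted to the tangent space `T` -/

omit [FiniteDimensional ℝ E] in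
/-- **UNIQUENESS ON THE TANGENT SPACE**: if `Δ` is positive on `T` (`0 < ⟨z, Δz⟩` for `z ∈ T`, `z ≠ 0` — print: `Δ_a` is positive definite, [15] (128)–(129),
[Balaban1984PropagatorsI] (1.72)), two elements of `T` with the same pairings `⟨δ, Δ·⟩` against all `δ ∈ T` coincide. [folklore] -/
theorem restricted_solution_unique (T : Submodule ℝ E) (Δ : E →ₗ[ℝ] E) (hpos : ∀ z ∈ T, z ≠ 0 → 0 < ⟪z, Δ z⟫)
    {z₁ z₂ : E} (hz₁ : z₁ ∈ T) (hz₂ : z₂ ∈ T) (h : ∀ δ ∈ T, ⟪δ, Δ z₁⟫ = ⟪δ, Δ z₂⟫) : z₁ = z₂ := by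
  by_contra hne
  have hd : z₁ - z₂ ∈ T := T.sub_mem hz₁ hz₂
  have hne' : z₁ - z₂ ≠ 0 := sub_ne_zero.2 hne
  have h0 : ⟪z₁ - z₂, Δ (z₁ - z₂)⟫ = 0 := by
    rw [map_sub, inner_sub_right, h _ hd, sub_self]
  exact (hpos _ hd hne').ne' h0

/-- **EXISTENCE AND UNIQUENESS OF THE RESTRICTED SOLUTION** (the minimum∕critical point of `½⟨A′, Δ_aA′⟩ − ⟨A′, w⟩` on the tangent space, p. 298): for `Δ`
positive on the finite-dimensional subspace `T`, every `w ∈ E` has exactly one `z ∈ T` with `⟨δ, Δz⟩ = ⟨δ, w⟩` for all `δ ∈ T`.  Proof: the compression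
`z ↦ P_T(Δz)` of `Δ` to `T` is injective by positivity, hence bijective (`T` finite-dimensional). [cite: Balaban1985Variational, (128)–(131) p.298] -/
theorem existsUnique_restricted_solution (T : Submodule ℝ E) (Δ : E →ₗ[ℝ] E) (hpos : ∀ z ∈ T, z ≠ 0 → 0 < ⟪z, Δ z⟫) (w : E) :
    ∃! z : E, z ∈ T ∧ ∀ δ ∈ T, ⟪δ, Δ z⟫ = ⟪δ, w⟫ := by
  haveI : CompleteSpace T := FiniteDimensional.complete ℝ T
  -- the compression of Δ to T
  let C : T →ₗ[ℝ] T := (T.orthogonalProjectionOnto : E →L[ℝ] T).toLinearMap ∘ₗ Δ ∘ₗ T.subtype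
  have hC : ∀ (z δ : T), ⟪(δ : E), ((C z : T) : E)⟫ = ⟪(δ : E), Δ z⟫ := by
    intro z δ
    show ⟪(δ : E), ((T.orthogonalProjectionOnto (Δ (z : E)) : T) : E)⟫ = ⟪(δ : E), Δ z⟫
    rw [← Submodule.coe_inner, Submodule.inner_orthogonalProjectionOnto_eq_of_mem_left]
  have hinj : Function.Injective C := by
    intro z₁ z₂ h12
    apply Subtype.ext
    refine restricted_solution_unique T Δ hpos z₁.2 z₂.2 fun δ hδ => ?_
    have e1 := hC z₁ ⟨δ, hδ⟩
    have e2 := hC z₂ ⟨δ, hδ⟩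
    simp only at e1 e2
    rw [← e1, ← e2, h12]
  have hsurj : Function.Surjective C := LinearMap.injective_iff_surjective.1 hinj
  obtain ⟨z, hz⟩ := hsurj (T.orthogonalProjectionOnto w)
  refine ⟨(z : E), ⟨z.2, fun δ hδ => ?_⟩, fun z' hz' => ?_⟩
  · have e := hC z ⟨δ, hδ⟩
    have hP := Submodule.inner_orthogonalProjectionOnto_eq_of_mem_left (⟨δ, hδ⟩ : T) w
    rw [Submodule.coe_inner] at hP
    simp only at e hP
    rw [← e, hz, hP]
  · refine restricted_solution_unique T Δ hpos hz'.1 z.2 fun δ hδ => ?_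
    have e := hC z ⟨δ, hδ⟩
    have hP := Submodule.inner_orthogonalProjectionOnto_eq_of_mem_left (⟨δ, hδ⟩ : T) w
    rw [Submodule.coe_inner] at hP
    simp only at e hP
    rw [hz'.2 δ hδ, ← e, hz, hP]

/-- ★ **THE RESTRICTED SOLUTION OPERATOR `G̃` IS LINEAR** (*«GP₀* = G − GQ*(QGQ*)⁻¹QG = G̃»*, p. 300, characterised without coordinates): for `Δ` positive on `T`
there is a (unique) ℝ-linear `G̃ : E → E` with values in `T` such that `⟨δ, Δ(G̃w)⟩ = ⟨δ, w⟩` for all `δ ∈ T`, `w ∈ E`; and every `z ∈ T` with these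
pairings equals `G̃w`. [cite: Balaban1985Variational, (131) p.298, (143) p.300] -/
theorem exists_restrictedSolutionOp (T : Submodule ℝ E) (Δ : E →ₗ[ℝ] E) (hpos : ∀ z ∈ T, z ≠ 0 → 0 < ⟪z, Δ z⟫) :
    ∃ G : E →ₗ[ℝ] E, (∀ w, G w ∈ T ∧ ∀ δ ∈ T, ⟪δ, Δ (G w)⟫ = ⟪δ, w⟫) ∧
      ∀ (w z : E), z ∈ T → (∀ δ ∈ T, ⟪δ, Δ z⟫ = ⟪δ, w⟫) → z = G w := by
  classical
  -- the solution function and its characterisation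
  have hsol := fun w => existsUnique_restricted_solution T Δ hpos w
  choose g hg hguniq using fun w => (hsol w).exists
  have huniq : ∀ (w z : E), z ∈ T → (∀ δ ∈ T, ⟪δ, Δ z⟫ = ⟪δ, w⟫) → z = g w := fun w z hz h =>
    restricted_solution_unique T Δ hpos hz (hg w) fun δ hδ => by rw [h δ hδ, hguniq w δ hδ]
  refine ⟨{ toFun := g, map_add' := fun w₁ w₂ => ?_, map_smul' := fun c w => ?_ }, fun w => ⟨hg w, hguniq w⟩,
    fun w z hz h => huniq w z hz h⟩
  · symm
    refine huniq (w₁ + w₂) (g w₁ + g w₂) (T.add_mem (hg w₁) (hg w₂)) fun δ hδ => ?_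
    rw [map_add, inner_add_right, inner_add_right, hguniq w₁ δ hδ, hguniq w₂ δ hδ]
  · symm
    refine huniq (c • w) (c • g w) (T.smul_mem c (hg w)) fun δ hδ => ?_
    simp only [map_smul, inner_smul_right, hguniq w δ hδ]

/-! ## §2  (127) ⟹ (128): the gauge term `DRD*` and the penalty `aQ*Q` do not change the pairing on the tangent space -/

omit [FiniteDimensional ℝ E] in
/-- **(127) ⟹ (128)**: if `Δ_a = Δ + N + P` with `N A′ = 0` (print: `N = DRD*`, *«the configuration A′₁ satisfies RD*A′₁ = 0»*) and `⟨δ, PA′⟩ = 0` for all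
`δ ∈ T` (print: `P = Q*aQ`, `QδA′ = 0`), then `⟨δ, ΔA′ + w⟩ = 0` on `T` iff `⟨δ, Δ_aA′ + w⟩ = 0` on `T`. [cite: Balaban1985Variational, (127)–(128) p.297] -/
theorem critical128_of_critical127 (T : Submodule ℝ E) (Δ N P Δa : E →ₗ[ℝ] E) (hΔa : Δa = Δ + N + P) {A' w : E} (hN : N A' = 0)
    (hP : ∀ δ ∈ T, ⟪δ, P A'⟫ = 0) (h127 : ∀ δ ∈ T, ⟪δ, Δ A' + w⟫ = 0) : ∀ δ ∈ T, ⟪δ, Δa A' + w⟫ = 0 := by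
  intro δ hδ
  rw [hΔa, LinearMap.add_apply, LinearMap.add_apply, hN, add_zero, add_right_comm, inner_add_right, h127 δ hδ, hP δ hδ, add_zero]

omit [FiniteDimensional ℝ E] in
/-- The penalty hypothesis of `critical128_of_critical127` for print's `P = aQ*Q` on `T = ker Q`: if `P = a·(Q† ∘ Q)` for some `Q† : F → E` adjoint to `Q`
on `T` in the sense `⟨δ, Q†y⟩ = 0` whenever `Qδ = 0` — which is what `⟨δ, Q*y⟩ = ⟨Qδ, y⟩` gives —, then `⟨δ, PA′⟩ = 0` for `δ ∈ ker Q`.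
[cite: Balaban1985Variational, (128) p.297] -/
theorem penalty_orthogonal_on_ker (Q : E →ₗ[ℝ] F) (Qdag : F →ₗ[ℝ] E) (hadj : ∀ (δ : E) (y : F), Q δ = 0 → ⟪δ, Qdag y⟫ = 0)
    (a : ℝ) (A' : E) : ∀ δ ∈ LinearMap.ker Q, ⟪δ, (a • (Qdag ∘ₗ Q)) A'⟫ = 0 := by
  intro δ hδ
  rw [LinearMap.smul_apply, inner_smul_right, LinearMap.comp_apply, hadj δ _ (LinearMap.mem_ker.1 hδ), mul_zero]

/-! ## §3  (128) ⟹ (132) ⟹ (133)∕(143) ⟹ (158) -/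

omit [FiniteDimensional ℝ E] in
/-- **(128) ⟹ (132): THE TANGENT COMPONENT OF THE CRITICAL CONFIGURATION SOLVES THE RESTRICTED PROBLEM.**  Let `H : F → E` be a right inverse of
`Q` (`Q(HB) = B`) whose range is `Δ_a`-orthogonal to `ker Q` (*«By the definition of H₀B and the condition QδA′ = 0 we have ⟨δA′, Δ_aH₀B⟩ = 0»* — print's
`H₀ = GQ*(QGQ*)⁻¹` (129), or Sect. F's Landau-gauge `H` (45)∕(157)).  If `⟨δ, Δ_aA′ + w⟩ = 0` for all `δ ∈ ker Q` ((128) with `w = J + ((δ∕δA′)V)(A′)`), then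
`A₀ := A′ − H(QA′)` lies in `ker Q` (*«QA₀ = 0, hence P₀A₀ = A₀»*) and `⟨δ, Δ_aA₀ + w⟩ = 0` for all `δ ∈ ker Q`. [cite: Balaban1985Variational, (128)–(132) p.298] -/
theorem restricted_of_critical128 (Δa : E →ₗ[ℝ] E) (Q : E →ₗ[ℝ] F) (H : F →ₗ[ℝ] E) (hQH : ∀ B, Q (H B) = B)
    (hHorth : ∀ δ ∈ LinearMap.ker Q, ∀ B, ⟪δ, Δa (H B)⟫ = 0) {A' w : E} (h128 : ∀ δ ∈ LinearMap.ker Q, ⟪δ, Δa A' + w⟫ = 0) :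
    A' - H (Q A') ∈ LinearMap.ker Q ∧ ∀ δ ∈ LinearMap.ker Q, ⟪δ, Δa (A' - H (Q A')) + w⟫ = 0 := by
  refine ⟨?_, fun δ hδ => ?_⟩
  · rw [LinearMap.mem_ker, map_sub, hQH, sub_self]
  · rw [map_sub, sub_add_eq_add_sub, inner_sub_right, h128 δ hδ, hHorth δ hδ, sub_zero]

omit [FiniteDimensional ℝ E] in
/-- ★ **(128) ⟹ (133)∕(143): `A₀ = −G̃w`.**  With `G̃` the restricted solution operator of §1 on `T = ker Q` (given here by its two characterising properties:
values in `ker Q`, pairings `⟨δ, Δ_a(G̃v)⟩ = ⟨δ, v⟩` on `ker Q`), `Δ_a` positive on `ker Q`, and `H` as in `restricted_of_critical128`: criticality (128) forces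
`A′ − H(QA′) = −G̃w` — *«A₀ = −GP₀*J … − GP₀*((δ∕δA′)V)(A₀ + H₀B) (133)»*, *«A₀ = −G̃J + … − G̃((δ∕δA′)V)(A₀ + H₀B) (143)»* with `w = J + ((δ∕δA′)V)(A′)`
(background `1`: `J = 0`, `Δ^{(2)} = 0`).  The coordinate instance (`E = ι → ℝ`, dot product) is UST `FlatCriticalEquation143.eq143_of_critical`.
[cite: Balaban1985Variational, (133) p.298, (143) p.300] -/
theorem eq143_of_critical128 (Δa : E →ₗ[ℝ] E) (Q : E →ₗ[ℝ] F) (hpos : ∀ z ∈ LinearMap.ker Q, z ≠ 0 → 0 < ⟪z, Δa z⟫)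
    (G : E →ₗ[ℝ] E) (hG : ∀ v, G v ∈ LinearMap.ker Q ∧ ∀ δ ∈ LinearMap.ker Q, ⟪δ, Δa (G v)⟫ = ⟪δ, v⟫)
    (H : F →ₗ[ℝ] E) (hQH : ∀ B, Q (H B) = B) (hHorth : ∀ δ ∈ LinearMap.ker Q, ∀ B, ⟪δ, Δa (H B)⟫ = 0)
    {A' w : E} (h128 : ∀ δ ∈ LinearMap.ker Q, ⟪δ, Δa A' + w⟫ = 0) : A' - H (Q A') = -(G w) := by
  obtain ⟨hmem, hres⟩ := restricted_of_critical128 Δa Q H hQH hHorth h128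
  refine restricted_solution_unique (LinearMap.ker Q) Δa hpos hmem (Submodule.neg_mem _ (hG w).1) fun δ hδ => ?_
  have e1 : ⟪δ, Δa (A' - H (Q A'))⟫ = -⟪δ, w⟫ := by
    have := hres δ hδ
    rw [inner_add_right] at this
    linarith
  rw [e1, map_neg, inner_neg_right, (hG w).2 δ hδ]

omit [FiniteDimensional ℝ E] in
/-- ★ **(143) ⟹ (158) — THE EQUATION SHAPE OF PROP. 6**: at background `1` (`J = 0`, `w = W(A′)` with `W = (δ∕δA′)V`), writing `B := QA′`, `𝔄 := HB` and
`A₁ := A′ − HB`, criticality (128) gives *«A₁ + G̃((δ∕δA′)V)(A₁ + HB) = 0. (158)»* — LITERALLY the equation `A₁ + G (W (A₁ + 𝔄)) = 0` of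
`FlatSmallSolution158*.existsUnique_smallSolution158*` ∕ this seat's `K0Stub1FlatSmallSolution158AtRecord`, whose unique small solution therefore IS the
tangent component of the critical configuration once the sizes match (Prop. 6's ball). [cite: Balaban1985Variational, (158) p.302, (143) p.300] -/
theorem eq158_of_critical128 (Δa : E →ₗ[ℝ] E) (Q : E →ₗ[ℝ] F) (hpos : ∀ z ∈ LinearMap.ker Q, z ≠ 0 → 0 < ⟪z, Δa z⟫)
    (G : E →ₗ[ℝ] E) (hG : ∀ v, G v ∈ LinearMap.ker Q ∧ ∀ δ ∈ LinearMap.ker Q, ⟪δ, Δa (G v)⟫ = ⟪δ, v⟫)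
    (H : F →ₗ[ℝ] E) (hQH : ∀ B, Q (H B) = B) (hHorth : ∀ δ ∈ LinearMap.ker Q, ∀ B, ⟪δ, Δa (H B)⟫ = 0)
    (W : E → E) {A' : E} (h128 : ∀ δ ∈ LinearMap.ker Q, ⟪δ, Δa A' + W A'⟫ = 0) :
    (A' - H (Q A')) + G (W ((A' - H (Q A')) + H (Q A'))) = 0 := by
  rw [sub_add_cancel, eq143_of_critical128 Δa Q hpos G hG H hQH hHorth h128, neg_add_cancel]

omit [FiniteDimensional ℝ E] in
/-- **THE CONVERSE (143) ⟹ (128)**: if `A′ − H(QA′) = −G̃w` with `G̃`, `H` as above, then `⟨δ, Δ_aA′ + w⟩ = 0` on `ker Q` — the equation (143)∕(158) IS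
criticality on the tangent space (print p. 300: *«The above equation is satisfied for arbitrary A′»* read backwards). [cite: Balaban1985Variational, (132)–(133) p.298, (143) p.300] -/
theorem critical128_of_eq143 (Δa : E →ₗ[ℝ] E) (Q : E →ₗ[ℝ] F)
    (G : E →ₗ[ℝ] E) (hG : ∀ v, G v ∈ LinearMap.ker Q ∧ ∀ δ ∈ LinearMap.ker Q, ⟪δ, Δa (G v)⟫ = ⟪δ, v⟫)
    (H : F →ₗ[ℝ] E) (hHorth : ∀ δ ∈ LinearMap.ker Q, ∀ B, ⟪δ, Δa (H B)⟫ = 0)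
    {A' w : E} (h143 : A' - H (Q A') = -(G w)) : ∀ δ ∈ LinearMap.ker Q, ⟪δ, Δa A' + w⟫ = 0 := by
  intro δ hδ
  have hA' : A' = -(G w) + H (Q A') := by rw [← h143, sub_add_cancel]
  rw [hA', map_add, map_neg, inner_add_right, inner_add_right, inner_neg_right, (hG w).2 δ hδ, hHorth δ hδ, add_zero, neg_add_cancel]

/-- ★ **THE WHOLE STEP (127) ⟹ (158) IN ONE SENTENCE, WITH `G̃` PRODUCED** (for the record's consumer): `Δ_a` positive on `ker Q`, `H` a right inverse of `Q`
with `Δ_a`-range orthogonal to `ker Q`; then there is a linear `G̃` (values in `ker Q`, the restricted solution operator) such that for EVERY map `W` and every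
`A′` critical in the sense (128) (`⟨δ, Δ_aA′ + W(A′)⟩ = 0` on `ker Q`), `A₁ := A′ − H(QA′)` solves `A₁ + G̃(W(A₁ + H(QA′))) = 0`.
[cite: Balaban1985Variational, (127)–(133) pp.297–298, (143) p.300, (158) p.302] -/
theorem exists_Gt_eq158_of_critical128 (Δa : E →ₗ[ℝ] E) (Q : E →ₗ[ℝ] F) (hpos : ∀ z ∈ LinearMap.ker Q, z ≠ 0 → 0 < ⟪z, Δa z⟫)
    (H : F →ₗ[ℝ] E) (hQH : ∀ B, Q (H B) = B) (hHorth : ∀ δ ∈ LinearMap.ker Q, ∀ B, ⟪δ, Δa (H B)⟫ = 0) :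
    ∃ G : E →ₗ[ℝ] E, (∀ v, G v ∈ LinearMap.ker Q ∧ ∀ δ ∈ LinearMap.ker Q, ⟪δ, Δa (G v)⟫ = ⟪δ, v⟫) ∧
      ∀ (W : E → E) (A' : E), (∀ δ ∈ LinearMap.ker Q, ⟪δ, Δa A' + W A'⟫ = 0) →
        (A' - H (Q A')) + G (W ((A' - H (Q A')) + H (Q A'))) = 0 := by
  obtain ⟨G, hG, -⟩ := exists_restrictedSolutionOp (LinearMap.ker Q) Δa hpos
  exact ⟨G, hG, fun W A' h128 => eq158_of_critical128 Δa Q hpos G hG H hQH hHorth W h128⟩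

end Summit.QuantumFields.YangMills.Theorems.K0Stub1CriticalEquation143CoordFree

end
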